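import Summits.RiemannHypothesis.RiemannHypothesis.Theorems.IntegerScrewCensusFloor96A

/-!
# Route `IntegerScrew` — census cell `M096-T375-dd` in the kernel: the DUAL checker on the cells `11 ≤ c < 44` (part B)

KERNEL FACTS (`decide +kernel`): `dualCheckW 95 375 40 EB 6000 a b … = true` on sub-ranges of `[11, 44)` for the dual
certificate literal `dpats96/deps96` of `IntegerScrewCensusFloor96A`.  RH-free; nothing here bears on the truth of RH.
-/

set_option linter.dupNamespace false
set_option autoImplicit false

namespace Summit.RiemannHypothesis.RiemannHypothesis.Theorems.IntegerScrew.Manifest.Fast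

open Literature.Analysis.ValidatedNumerics Literature.Analysis.ValidatedNumerics.Numerics

set_option maxRecDepth 200000 in
set_option maxHeartbeats 0 in
/-- KERNEL FACT: the cells `11 ≤ c < 22` pass. -/
theorem dualCheckW_96_11_22 : dualCheckW 95 375 40 EB 6000 11 22 logs113s dpats96 deps96 = true := by
  decide +kernel

set_option maxRecDepth 200000 in
set_option maxHeartbeats 0 in
/-- KERNEL FACT: the cells `22 ≤ c < 33` pass. -/
theorem dualCheckW_96_22_33 : dualCheckW 95 375 40 EB 6000 22 33 logs113s dpats96 deps96 = true := by
  decide +kernel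

set_option maxRecDepth 200000 in
set_option maxHeartbeats 0 in
/-- KERNEL FACT: the cells `33 ≤ c < 44` pass. -/
theorem dualCheckW_96_33_44 : dualCheckW 95 375 40 EB 6000 33 44 logs113s dpats96 deps96 = true := by
  decide +kernel

end Summit.RiemannHypothesis.RiemannHypothesis.Theorems.IntegerScrew.Manifest.Fast
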